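import Literature.Topology.FourManifolds.KirbyMovesSlideAlign
import Literature.Topology.FourManifolds.WildStrandBand
import Literature.Topology.FourManifolds.CircleHomotopySurjective
import Literature.Topology.FourManifolds.BandCoreRebuild
import Literature.Topology.FourManifolds.TubeSurgery
import Literature.Topology.FourManifolds.KnotGroupTubular
import HarnessLib

/-!
# Refutation of the mis-stated slide lemma (S₁ᵃ) `slideDiffeoAligned`

Topic `Literature/Topology/FourManifolds`. The named fact
`Literature.Topology.FourManifolds.FramedLink.IsStrictHandleSlide.slideDiffeoAligned`
(`KirbyMovesSlideAlign.lean`; vendored for R. C. Kirby, *The Topology of 4-Manifolds* (1989),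
Ch. I §4, as a leaf of the split of the slide lemma (S) `FramedLink.IsStrictHandleSlide.slideModel`)
is **false as typed**, as recorded in prose in the module docstrings of `KirbyMovesSlideAlign.lean`
and `KirbyMovesSlideModel.lean` (§ Status, review of the split, 2026-08-15). This file makes the
refutation a theorem:

* `Literature.Topology.FourManifolds.FramedLink.IsStrictHandleSlide.not_slideDiffeoAligned :
  ¬ slideDiffeoAligned.{u}` (every universe `u`; index type `ULift (Fin 2)`).

**The counterexample** (`WildStrandBand.lean`, in the coordinates of one tubular neighbourhood
`μ` of the unknot `K`): `ι = ULift (Fin 2)`, `L = (Kᵢ, Kⱼ) = (KI μ, K)` with `Kᵢ` the reversed strand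
`x ↦ μ (x̄, p)`, `p = (1 + 1/√5, 0)`; the slide tube `ν = slideTube μ = μ.squeeze 1` of `Kⱼ = K`
(image the open unit tube, off `Kᵢ`), push-off `Kⱼ' = P μ`, the strand at `q = (1/√5, 0)`;
`L' = (K', K)` with `K'` the band sum of `Kᵢ` and `Kⱼ'` along the **wild band** `band μ`
(`BandCore.rebuildData`, `BandCoreRebuild.lean`), a genuine `BandData` avoiding
`Kⱼ ∪ ν.collar` whose support nevertheless contains the punctured meridian disc
`G = {μ (circlePoint (3/5), p + w) | 0 < ‖w‖ < 1/50}` of `Kᵢ` (`WildStrand.mem_support`) — the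
tree's `BandData` (`BandSum.lean`) constrains the band only on the *open* collar square, where the
wild band is an honest injective immersion.

**The obstruction** (`CircleHomotopySurjective.lean`): (S₁ᵃ) provides, for the aligned
presentation of the surgered manifold (`TubeNbhd.surgery_exists_with`, `TubeSurgery.lean`), `T = ∅`
and the thin tube `Vᵢ = μ (S¹ × B(p, 1/50)) ⊇ Kᵢ`, a tubular neighbourhood `μᵢ ⊆ Vᵢ` of `Kᵢ` with
`range μᵢ.pushOff` disjoint from the support of the band. But the push-off `x ↦ μᵢ (x, e₀)` is
homotopic to `Kᵢ` inside `Vᵢ` (radially, `σ ↦ μᵢ (x, σ e₀)`); reading the homotopy in the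
coordinates of `μ`, its angular part is a loop of loops in `S¹` starting at the reversed standard
loop, so its final loop is onto (`exists_apply_eq_of_apply_zero_eq_circlePoint_neg`: degree `-1`
loops are not null-homotopic) and passes through the angle `3/5`; there the fibre coordinate is
within `1/50` of `p` (we are in `Vᵢ`) and `≠ p` (the push-off misses `Kᵢ`), i.e. the push-off
meets `G ⊆ support`. Contradiction.

Kirby's printed move (Ch. I §4, p. 10, Figs. 4.2–4.4) slides along an embedded *closed* band and
says nothing about push-offs of `Kᵢ` missing a band surface; the vendored statement is wider than
the source and false in that width, which is why (S₁ᵃ) and its parent (S₁) were merged back into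
(S) (to be proved directly). Everything here is proved; no named facts are introduced.

## References

* R. C. Kirby, *The Topology of 4-Manifolds*, LNM 1374, Springer (1989), Ch. I §4, §5 Thm. 5.1.
  [cite: Kirby1989, Ch. I §4]
* A. Hatcher, *Algebraic Topology* (2002), §1.1 Thm. 1.7 (degree of circle maps).
  [cite: HatcherAT2002, §1.1 Thm. 1.7]
-/

noncomputable section

open Set Real Filter Function
open scoped Manifold ContDiff Topology

namespace Literature.Topology.FourManifolds

/-- Local notation: `𝔼 n` is the model Euclidean space `EuclideanSpace ℝ (Fin n)`. -/
local notation "𝔼 " n:arg => EuclideanSpace ℝ (Fin n)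

/-- Local notation: `𝕊 n` is the unit sphere in `EuclideanSpace ℝ (Fin (n + 1))`. -/
local notation "𝕊 " n:arg => (Metric.sphere (0 : EuclideanSpace ℝ (Fin (n + 1))) 1)

namespace WildStrand

open WildFlap

variable {K : Knot} (μ : Knot.TubularNbhd K)

/-! ## The two framed links and the band data -/

/-- The attaching strand misses the knot. [folklore] -/
theorem disjoint_range_KI_range : Disjoint (range ⇑(KI μ)) (range ⇑K) := by
  rw [Set.disjoint_left, range_KI]
  rintro _ hz ⟨u, hu⟩
  obtain ⟨x, rfl⟩ := (mem_image_singleton_iff μ).1 hz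
  rw [← μ.coe_apply_zero] at hu
  exact pI_ne_zero (congrArg Prod.snd (μ.injective hu)).symm

/-- The push-off strand misses the knot. [folklore] -/
theorem disjoint_range_P_range : Disjoint (range ⇑(P μ)) (range ⇑K) := by
  rw [Set.disjoint_left, range_P]
  rintro _ hz ⟨u, hu⟩
  obtain ⟨x, rfl⟩ := (mem_image_singleton_iff μ).1 hz
  rw [← μ.coe_apply_zero] at hu
  exact q_ne_zero (congrArg Prod.snd (μ.injective hu)).symm

/-- The two strands are disjoint. [folklore] -/
theorem disjoint_range_KI_range_P : Disjoint (range ⇑(KI μ)) (range ⇑(P μ)) := by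
  rw [Set.disjoint_left, range_KI, range_P]
  rintro _ hz hz'
  obtain ⟨x, rfl⟩ := (mem_image_singleton_iff μ).1 hz
  exact pI_ne_q ((apply_mem_image_singleton_iff μ).1 hz')

/-- **The framed link `L = (Kᵢ, Kⱼ) = (KI μ, K)`** (framings `0`). [folklore] -/
def linkL : FramedLink (Fin 2) where
  component := ![KI μ, K]
  disjoint := by
    intro i j hij
    fin_cases i <;> fin_cases j
    · exact absurd rfl hij
    · exact disjoint_range_KI_range μ
    · exact (disjoint_range_KI_range μ).symm
    · exact absurd rfl hij
  framing := fun _ ↦ 0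

/-- The wild band as a band core. [folklore] -/
def core : BandCore (KI μ) (P μ) (range ⇑K ∪ (slideTube μ).collar) := (preBandData μ).toCore

/-- **The band sum `K'`** of `Kᵢ` and `Kⱼ'` along the wild band (the rebuilt knot of
`BandCoreRebuild.lean`). [folklore] -/
def K' : Knot := (core μ).rebuild (disjoint_range_KI_range_P μ)

/-- **The band data** of the wild band, with the rebuilt knot as its result. [folklore] -/
def bandData : BandData (KI μ) (P μ) (K' μ) (range ⇑K ∪ (slideTube μ).collar) :=
  (core μ).rebuildData (disjoint_range_KI_range_P μ)

/-- The support of the band data is the image of the open square under the wild band. [folklore] -/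
theorem support_bandData : (bandData μ).support = band μ '' squareNhd (1 / 10) := rfl

/-- The rebuilt knot lies in `Kᵢ ∪ Kⱼ' ∪ support`. [folklore] -/
theorem range_K'_subset :
    range ⇑(K' μ) ⊆ range ⇑(KI μ) ∪ range ⇑(P μ) ∪ band μ '' squareNhd (1 / 10) := by
  intro z hz
  by_cases hs : z ∈ band μ '' squareNhd (1 / 10)
  · exact Or.inr hs
  · have : z ∈ range ⇑(K' μ) \ (bandData μ).band '' squareNhd (bandData μ).δ := ⟨hz, hs⟩
    rw [(bandData μ).range_diff] at this
    exact Or.inl this.1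

/-- The rebuilt knot misses `K`. [folklore] -/
theorem disjoint_range_K'_range : Disjoint (range ⇑(K' μ)) (range ⇑K) := by
  refine Set.disjoint_left.2 fun z hz hzK ↦ ?_
  rcases range_K'_subset μ hz with (h | h) | h
  · exact Set.disjoint_left.1 (disjoint_range_KI_range μ) h hzK
  · exact Set.disjoint_left.1 (disjoint_range_P_range μ) h hzK
  · exact Set.disjoint_left.1 (disjoint_avoid μ) h (Or.inl hzK)

/-- **The framed link `L' = (K', Kⱼ)`** (framings `0`). [folklore] -/
def linkL' : FramedLink (Fin 2) where
  component := ![K' μ, K]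
  disjoint := by
    intro i j hij
    fin_cases i <;> fin_cases j
    · exact absurd rfl hij
    · exact disjoint_range_K'_range μ
    · exact (disjoint_range_K'_range μ).symm
    · exact absurd rfl hij
  framing := fun _ ↦ 0

universe u

/-- The framed link `L`, indexed by `ULift (Fin 2)` (any universe). [folklore] -/
def linkLU : FramedLink (ULift.{u} (Fin 2)) := (linkL μ).reindex Equiv.ulift

/-- The framed link `L'`, indexed by `ULift (Fin 2)` (any universe). [folklore] -/
def linkLU' : FramedLink (ULift.{u} (Fin 2)) := (linkL' μ).reindex Equiv.ulift

/-- The band data with the avoided set spelled as in (S₁ᵃ) (index type `ULift (Fin 2)`).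
[folklore] -/
def bandData' : BandData ((linkLU.{u} μ).component ⟨0⟩) (slideTube μ).pushOff
    ((linkLU'.{u} μ).component ⟨0⟩)
    ((⋃ k ∈ {k : ULift.{u} (Fin 2) | k ≠ ⟨0⟩}, range ⇑((linkLU.{u} μ).component k)) ∪
      (slideTube μ).collar) :=
  (bandData μ).mono (by
    refine union_subset_union_left _ ?_
    intro z hz
    simp only [mem_iUnion, mem_setOf_eq, exists_prop] at hz
    obtain ⟨⟨k⟩, hk, hz⟩ := hz
    fin_cases k
    · exact absurd rfl hk
    · exact hz)

/-- The slide tube misses `Kᵢ` (its image is the open unit tube, `‖p‖ > 1`). [folklore] -/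
theorem disjoint_range_slideTube_range_KI : Disjoint (range ⇑(slideTube μ)) (range ⇑(KI μ)) := by
  rw [Set.disjoint_left, range_slideTube, range_KI]
  rintro _ ⟨⟨x, w⟩, ⟨-, hw⟩, rfl⟩ hz
  have := (apply_mem_image_singleton_iff μ).1 hz
  rw [this, Metric.mem_ball, dist_zero_right, norm_pI] at hw
  linarith [qc_pos]

/-! ## The refutation -/

attribute [local instance] fact_finrank_euclideanSpace_two fact_finrank_euclideanSpace_four

-- `slideDiffeoAligned` carries the `deprecated` attribute precisely because it is refuted as
-- stated; this theorem is that refutation, so the deprecation warning is silenced here.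
set_option linter.deprecated false in
/-- **(S₁ᵃ) is false**, for the configuration built from any tubular neighbourhood `μ` of any knot:
the push-off of every tubular neighbourhood of `Kᵢ` inside the thin tube `μ (S¹ × B(p, 1/50))`
meets the punctured meridian disc `{μ (circlePoint (3/5), p + w) | 0 < ‖w‖ < 1/50} ⊆ support`
(degree of the angular part of the radial homotopy). [folklore] -/
theorem not_slideDiffeoAligned_of (μ : Knot.TubularNbhd K) :
    ¬ FramedLink.IsStrictHandleSlide.slideDiffeoAligned.{u} := by
  intro hA
  have h01 : (⟨0⟩ : ULift.{u} (Fin 2)) ≠ ⟨1⟩ := fun h ↦ by cases h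
  have hrest : ∀ k : ULift.{u} (Fin 2), k ≠ ⟨0⟩ →
      (linkLU'.{u} μ).component k = (linkLU.{u} μ).component k := by
    rintro ⟨k⟩ hk
    fin_cases k
    · exact absurd rfl hk
    · rfl
  have hdisj : ∀ k : ULift.{u} (Fin 2), k ≠ ⟨1⟩ →
      Disjoint (range ⇑(slideTube μ)) (range ⇑((linkLU.{u} μ).component k)) := by
    rintro ⟨k⟩ hk
    fin_cases k
    · exact disjoint_range_slideTube_range_KI μ
    · exact absurd rfl hk
  obtain ⟨U, -, -, hmain⟩ := @hA (ULift.{u} (Fin 2)) _ (linkLU.{u} μ) (linkLU'.{u} μ) ⟨0⟩ ⟨1⟩ h01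
    (slideTube μ) (bandData'.{u} μ) hrest hdisj
  -- the aligned presentation of the surgered manifold for `s = 1/4`
  have hs : (0 : ℝ) < 1 / 4 := by norm_num
  obtain ⟨Y, _, _, _, _, _, _, jA, jB, hjA, hjAo, hjB, hjBo, hcov, hrel⟩ :=
    TubeNbhd.surgery_exists_with ((slideTube μ).scale (1 / 4) hs).toTubeNbhd
  -- the thin tube about `Kᵢ`
  set Vᵢ : Set (𝕊 3) := ⇑μ '' (univ ×ˢ Metric.ball pI (1 / 50)) with hVᵢ
  have hVo : IsOpen Vᵢ := μ.isOpenMap _ (isOpen_univ.prod Metric.isOpen_ball)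
  have hKV : range ⇑((linkLU.{u} μ).component ⟨0⟩) ⊆ Vᵢ := by
    change range ⇑(KI μ) ⊆ Vᵢ
    rw [range_KI]
    exact image_mono (prod_mono subset_rfl (singleton_subset_iff.2 (Metric.mem_ball_self (by norm_num))))
  obtain ⟨-, μᵢ, -, hμV, -, -, -, hsupp, -⟩ := hmain (1 / 4) hs le_rfl jA jB hjA hjAo hjB hjBo hcov
    hrel ∅ isCompact_empty (empty_subset _) Vᵢ hVo hKV univ isOpen_univ (subset_univ _)
  change Disjoint (range ⇑μᵢ.pushOff) (band μ '' squareNhd (1 / 10)) at hsupp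
  -- ### the radial homotopy from `Kᵢ` to the push-off, in the coordinates of `μ`
  have hVμ : Vᵢ ⊆ range ⇑μ := image_subset_range _ _
  set e := μ.isSmoothEmbedding.isEmbedding.toHomeomorph with he
  have he_apply : ∀ z, (e z : 𝕊 3) = μ z := fun z ↦ by
    rw [he, Topology.IsEmbedding.toHomeomorph_apply_coe]; rfl
  have he_symm : ∀ (z) (h : μ z ∈ range ⇑μ), e.symm ⟨μ z, h⟩ = z := fun z h ↦
    e.injective (by rw [e.apply_symm_apply]; exact Subtype.ext (he_apply z).symm)
  set Hh : ℝ × ℝ → 𝕊 3 := fun p ↦ μᵢ (circlePoint (2 * π * p.1), p.2 • framingBaseVector) with hHh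
  have hHc : Continuous Hh := by
    refine μᵢ.continuous.comp ((contMDiff_circlePoint.continuous.comp ?_).prodMk ?_)
    · exact (continuous_const.mul continuous_fst)
    · exact continuous_snd.smul continuous_const
  have hHmem : ∀ p, Hh p ∈ range ⇑μ := fun p ↦ hVμ (hμV (mem_range_self _))
  set A : ℝ × ℝ → 𝕊 1 := fun p ↦ (e.symm ⟨Hh p, hHmem p⟩).1 with hAdef
  have hAc : Continuous A :=
    continuous_fst.comp (e.symm.continuous.comp (hHc.subtype_mk _))
  -- at time `0` the loop is the reversed standard loop
  have hA0 : ∀ t ∈ Icc (0 : ℝ) 1, A (t, 0) = circlePoint (-(2 * π * t)) := by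
    intro t _
    have h1 : Hh (t, 0) = μ (circlePoint (-(2 * π * t)), pI) := by
      simp only [hHh, zero_smul, Knot.TubularNbhd.coe_apply_zero]
      exact KI_apply_circlePoint μ _
    simp only [hAdef]
    rw [show (⟨Hh (t, 0), hHmem (t, 0)⟩ : range ⇑μ) = ⟨μ (circlePoint (-(2 * π * t)), pI),
      h1 ▸ hHmem (t, 0)⟩ from Subtype.ext h1, he_symm]
  -- each time slice is a loop
  have hAper : ∀ σ ∈ Icc (0 : ℝ) 1, A (0, σ) = A (1, σ) := by
    intro σ _
    have : Hh (0, σ) = Hh (1, σ) := by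
      simp only [hHh, mul_zero, mul_one]
      rw [← circlePoint_add_two_pi 0, zero_add]
    simp only [hAdef]
    rw [show (⟨Hh (0, σ), hHmem (0, σ)⟩ : range ⇑μ) = ⟨Hh (1, σ), hHmem (1, σ)⟩ from Subtype.ext this]
  -- ### hence the final loop passes through the angle `3/5`
  obtain ⟨t, -, ht⟩ := exists_apply_eq_of_apply_zero_eq_circlePoint_neg hAc hA0 hAper
    (circlePoint (3 / 5))
  set z := e.symm ⟨Hh (t, 1), hHmem (t, 1)⟩ with hz
  have hμz : μ z = Hh (t, 1) := by
    have := congrArg Subtype.val (e.apply_symm_apply ⟨Hh (t, 1), hHmem (t, 1)⟩)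
    rw [he_apply] at this
    exact this
  have hz1 : z.1 = circlePoint (3 / 5) := ht
  -- the point is on the push-off of `μᵢ`
  have hpush : Hh (t, 1) ∈ range ⇑μᵢ.pushOff := ⟨circlePoint (2 * π * t), by
    rw [Knot.TubularNbhd.pushOff_apply, hHh]; simp⟩
  -- its fibre coordinate is within `1/50` of `p` ...
  have hW : ‖z.2 - pI‖ < 1 / 50 := by
    have hV : μ z ∈ Vᵢ := hμz ▸ hμV (mem_range_self _)
    obtain ⟨⟨x, w⟩, ⟨-, hw⟩, hxw⟩ := hV
    have := μ.injective hxw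
    rw [← this]
    simpa [dist_eq_norm] using hw
  -- ... and different from `p` (the push-off misses `Kᵢ`)
  have hW0 : z.2 - pI ≠ 0 := by
    intro h0
    have hzK : μ z ∈ range ⇑(KI μ) := by
      rw [range_KI, show z = (z.1, z.2) from rfl, sub_eq_zero.1 h0]
      exact (apply_mem_image_singleton_iff μ).2 rfl
    exact Set.disjoint_left.1 μᵢ.disjoint_range_pushOff hzK (hμz ▸ hpush)
  -- so it lies on the punctured meridian disc inside the support: contradiction
  have hmem := mem_support μ hW0 hW
  rw [← hz1, add_sub_cancel, show ((z.1, z.2) : (𝕊 1) × 𝔼 2) = z from rfl, hμz] at hmem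
  exact Set.disjoint_left.1 hsupp hpush hmem

end WildStrand

-- `slideDiffeoAligned` carries the `deprecated` attribute precisely because it is refuted as
-- stated; this theorem is that refutation, so the deprecation warning is silenced here.
set_option linter.deprecated false in
/-- **Refutation of (S₁ᵃ).** The named fact
`FramedLink.IsStrictHandleSlide.slideDiffeoAligned` (`KirbyMovesSlideAlign.lean`), vendored as a
leaf of the slide lemma for R. C. Kirby, *The Topology of 4-Manifolds* (1989), Ch. I §4, is false
as typed: instantiate the configuration of `WildStrandBand.lean` at a tubular neighbourhood of the
unknot (`WildStrand.not_slideDiffeoAligned_of`). The printed move slides along an embedded closed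
band; the tree's `BandData` only constrains the open collar square, and the push-off clause of
(S₁ᵃ) then fails for the wild band. [cite: Kirby1989, Ch. I §4] -/
theorem FramedLink.IsStrictHandleSlide.not_slideDiffeoAligned.{u} :
    ¬ FramedLink.IsStrictHandleSlide.slideDiffeoAligned.{u} := fun hA ↦ by
  obtain ⟨μ⟩ := Knot.nonempty_tubularNbhd_holds unknot
  exact WildStrand.not_slideDiffeoAligned_of.{u} μ hA

end Literature.Topology.FourManifolds
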